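import Literature.Analysis.FluidPDE.NSBoundedHigherRegularityQuantProofs
import Literature.Analysis.FluidPDE.SereginSverakBlowupCompactnessProofs
import Literature.Analysis.FluidPDE.CKN1982Setting
import HarnessLib

/-!
# Route HardyPointSink — `HardyAncientLimit`, step 7c: uniform bounds on the gradients of the
# blow-up sequence

Support file for item stmt-NavierStokesRegularity-9138 (`HardyAncientLimit`) of route
`HardyPointSink` (problem `NavierStokesRegularity`).

For a sequence of velocity fields `U_k` which, level by level (on the cylinders
`Q(a) = 𝒞(a) × ]-a², 0[`), are eventually bounded by `1`, continuous, and solve Navier–Stokes in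
the sense of distributions with SOME pressure of bounded `L^{3/2}` norm (the hypotheses of
`HardyAncientLimit.exists_blowup_limit`), the quantitative interior regularity of bounded
distributional solutions (Seregin–Šverák 2009, §2 p. 8 = Serrin's interior regularity with
constants; the tree's `NSBoundedHigherRegularityBounds_holds`) gives, at every point `(s, y)` with
`s < 0`, a ball `B(y, δ)` on which the slice gradients `∇U_k(s, ·)` are bounded and Hölder
continuous UNIFORMLY in `k` (`eventually_equiHolder_fderiv`). This feeds the convergence of the
gradients along the blow-up (`HardyAncientLimit.tendsto_fderiv_of_equicontinuous`).

## References

* G. Seregin, V. Šverák, Comm. PDE 34 (2009) = arXiv:0804.1803, §2 p. 8.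
* J. Serrin, Arch. Ration. Mech. Anal. 9 (1962) (interior regularity).
-/

noncomputable section

open Literature.Analysis.FluidPDE Literature.Analysis.FluidPDE.SereginSverak2009
open MeasureTheory Set Function Filter Topology Metric TopologicalSpace
open scoped ENNReal NNReal

namespace Summit.NavierStokesRegularity.NavierStokesRegularity.Theorems

namespace HardyAncientLimit

/-! ### First derivatives as `1`-st iterated derivatives -/

/-- The first iterated derivative is the Fréchet derivative read through a linear isometry, so
distances between first iterated derivatives (of any two functions at any two points) are the
distances between the Fréchet derivatives. [folklore] -/
theorem dist_iteratedFDeriv_one (f g : EuclideanSpace ℝ (Fin 3) → EuclideanSpace ℝ (Fin 3))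
    (x x' : EuclideanSpace ℝ (Fin 3)) :
    dist (iteratedFDeriv ℝ 1 f x) (iteratedFDeriv ℝ 1 g x') = dist (fderiv ℝ f x) (fderiv ℝ g x') := by
  rw [iteratedFDeriv_succ_eq_comp_right (f := f), iteratedFDeriv_succ_eq_comp_right (f := g),
    comp_apply, comp_apply, LinearIsometryEquiv.dist_map, iteratedFDeriv_zero_eq_comp,
    iteratedFDeriv_zero_eq_comp, comp_apply, comp_apply, LinearIsometryEquiv.dist_map]

/-! ### Geometry: a ball-cylinder about `(0, y)` containing the time `s` -/

/-- For `s < 0` and `R = |s| + 2`: `-R² < s` (so `(s, y') ∈ Q((0, y), R)` for `y' ∈ B(y, R)`).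
[folklore] -/
theorem neg_sq_lt_of_radius {s : ℝ} (hs : s < 0) : -(|s| + 2) ^ 2 < s := by
  have h1 : |s| = -s := abs_of_neg hs
  nlinarith [abs_nonneg s]

/-! ### Uniform gradient bounds at a point -/

/-- **Uniform Hölder bounds for the slice gradients of the blow-up sequence.** Let `U_k` satisfy,
for every `a > 0` and all large `k`: `‖U_k‖ ≤ 1` on `𝒞(a) × ]-a², 0]`, `U_k` continuous there,
`(U_k, P)` a distributional Navier–Stokes solution in `Q(a)` for some `P` with
`∫_{Q(a)} |P|^{3/2} ≤ c(a)`; and let the slices `U_k(s, ·)`, `s < 0`, be `C¹` for all large `k`.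
Then for every `s < 0` and `y` there are `δ > 0` and constants `B`, `K ≥ 0`, `α > 0` such that for
all large `k`: `‖∇U_k(s, y')‖ ≤ B` and `‖∇U_k(s, y') − ∇U_k(s, y'')‖ ≤ K |y' − y''|^α` on `B(y, δ)`
(Seregin–Šverák 2009, §2 p. 8, through `NSBoundedHigherRegularityBounds_holds` on the ball
`Q((0, y), δ + 1)`, `δ = |s| + 2`, its representative being `U_k` itself by continuity). -/
theorem eventually_equiHolder_fderiv
    (U : ℕ → ℝ → EuclideanSpace ℝ (Fin 3) → EuclideanSpace ℝ (Fin 3))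
    (hcont : ∀ a : ℝ, 0 < a → ∀ᶠ k in atTop, ContinuousOn (uncurry (U k)) (parCylTop a))
    (hb : ∀ a : ℝ, 0 < a → ∀ᶠ k in atTop, ∀ z ∈ parCylTop a, ‖U k z.1 z.2‖ ≤ 1)
    (hNS : ∀ a : ℝ, 0 < a → ∃ cst : ℝ≥0, ∀ᶠ k in atTop,
      ∃ P : ℝ → EuclideanSpace ℝ (Fin 3) → ℝ,
        IsDistributionalNSSolutionOn (parCylOpens 0 a) 1 0 (U k) P ∧
        ∫⁻ z in parCyl 0 a, ‖P z.1 z.2‖ₑ ^ (3 / 2 : ℝ) ≤ cst)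
    {s : ℝ} (hs : s < 0) (y : EuclideanSpace ℝ (Fin 3)) :
    ∃ δ : ℝ, 0 < δ ∧ ∃ B K α : ℝ, 0 ≤ K ∧ 0 < α ∧
      (∀ᶠ k in atTop, ∀ y' ∈ ball y δ, ‖fderiv ℝ (U k s) y'‖ ≤ B) ∧
      (∀ᶠ k in atTop, ∀ y' ∈ ball y δ, ∀ y'' ∈ ball y δ,
        dist (fderiv ℝ (U k s) y') (fderiv ℝ (U k s) y'') ≤ K * dist y' y'' ^ α) := by
  -- the ball-cylinder `Q((0, y), R₁)`, `R₁ = |s| + 2`, inside `Q((0, y), R₁ + 1) ⊆ Q(a)`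
  set R₁ : ℝ := |s| + 2 with hR₁
  have hR₁0 : 0 < R₁ := by rw [hR₁]; positivity
  set z₀ : ℝ × EuclideanSpace ℝ (Fin 3) := ((0 : ℝ), y) with hz₀
  have hsR : s ∈ Ioo (z₀.1 - R₁ ^ 2) z₀.1 := by
    refine ⟨?_, ?_⟩
    · show (0 : ℝ) - R₁ ^ 2 < s
      rw [zero_sub]
      exact neg_sq_lt_of_radius hs
    · exact hs
  obtain ⟨a, ha1, hQa⟩ := (show ∃ a : ℝ, 1 ≤ a ∧ parabolicCylinder (R₁ + 1) z₀ ⊆ parCyl 0 a from by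
    -- any parabolic ball with vertex at time `0` lies in some `Q(a)`
    set a : ℝ := (R₁ + 1) ^ 2 + ‖y‖ + (R₁ + 1) + 1 with ha
    have hRa : R₁ + 1 ≤ a := by rw [ha]; nlinarith [norm_nonneg y]
    refine ⟨a, by rw [ha]; nlinarith [norm_nonneg y], fun w hw => ?_⟩
    rw [mem_parabolicCylinder] at hw
    obtain ⟨⟨hw1, hw2⟩, hwx⟩ := hw
    have haa : a ≤ a ^ 2 := by nlinarith [norm_nonneg y]
    have hwy : ‖w.2‖ < a := by
      calc ‖w.2‖ ≤ dist w.2 y + ‖y‖ := by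
            have := norm_le_norm_add_norm_sub' w.2 y
            rw [dist_eq_norm]; linarith
        _ < (R₁ + 1) + ‖y‖ := by linarith [hwx]
        _ ≤ a := by rw [ha]; nlinarith [norm_nonneg y]
    rw [mem_parCyl_zero]
    refine ⟨⟨?_, hw2⟩, (cylRadius_le_norm' _).trans_lt hwy, ?_⟩
    · have : z₀.1 = 0 := rfl
      rw [this] at hw1
      nlinarith
    · calc |w.2 2| ≤ ‖w.2‖ := by simpa only [Real.norm_eq_abs] using PiLp.norm_apply_le w.2 2
        _ < a := hwy)
  have ha0 : 0 < a := by linarith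
  obtain ⟨cst, hcst⟩ := hNS a ha0
  -- the quantitative higher regularity on `Q((0, y), R₁ + 1)` with data `(R₁ + 1, 1, cst)`
  obtain ⟨Kf, Cf, αf, hαf, hfact⟩ := NSBoundedHigherRegularityBounds_holds (R₁ + 1) 1 cst
  have hR₁I : R₁ ∈ Ioo 0 (R₁ + 1) := ⟨hR₁0, by linarith⟩
  refine ⟨R₁, hR₁0, Kf 1 R₁, Cf 1 R₁, αf 1 R₁, (Cf 1 R₁).coe_nonneg, hαf 1 R₁ hR₁I, ?_⟩
  -- the common eventual set
  have hQtop : parabolicCylinder (R₁ + 1) z₀ ⊆ parCylTop a := hQa.trans (parCyl_zero_subset_parCylTop a)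
  have hQR : parabolicCylinder R₁ z₀ ⊆ parabolicCylinder (R₁ + 1) z₀ :=
    parabolicCylinder_mono hR₁0.le (by linarith) z₀
  have key : ∀ᶠ k in atTop, ∀ y' ∈ ball y R₁, ∀ y'' ∈ ball y R₁,
      ‖fderiv ℝ (U k s) y'‖ ≤ Kf 1 R₁ ∧
      dist (fderiv ℝ (U k s) y') (fderiv ℝ (U k s) y'') ≤ Cf 1 R₁ * dist y' y'' ^ (αf 1 R₁ : ℝ) := by
    filter_upwards [hcst, hcont a ha0, hb a ha0] with k hk hcontk hbk
    obtain ⟨P, hP, hPb⟩ := hk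
    -- the three hypotheses of the fact on the ball-cylinder
    have hdist : IsDistributionalNSSolutionOn (parabolicCylinderOpens (R₁ + 1) z₀) 1 0 (U k) P :=
      hP.of_le fun w hw => hQa hw
    have hbd : ∀ᵐ w ∂(volume.restrict (parabolicCylinder (R₁ + 1) z₀)), ‖U k w.1 w.2‖ ≤ 1 := by
      filter_upwards [ae_restrict_mem (isOpen_parabolicCylinder _ _).measurableSet] with w hw
      exact hbk w (hQtop hw)
    have hpb : ∫⁻ w in parabolicCylinder (R₁ + 1) z₀, ‖P w.1 w.2‖ₑ ^ (3 / 2 : ℝ) ≤ cst :=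
      (lintegral_mono_set hQa).trans hPb
    obtain ⟨V, hVae, -, hVH⟩ := hfact (U k) P z₀ hdist hbd hpb
    obtain ⟨hH0, -⟩ := hVH 0 R₁ hR₁I
    obtain ⟨hH1, hK1⟩ := hVH 1 R₁ hR₁I
    -- `V` is continuous on the open ball-cylinder, hence equal to `U k` there
    have hVc : ContinuousOn (fun w : ℝ × EuclideanSpace ℝ (Fin 3) => V w.1 w.2) (parabolicCylinder R₁ z₀) := by
      have h0 := hH0.continuousOn (hαf 0 R₁ hR₁I)
      have happ : Continuous fun L : ContinuousMultilinearMap ℝ (fun _ : Fin 0 => EuclideanSpace ℝ (Fin 3))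
          (EuclideanSpace ℝ (Fin 3)) => L 0 := continuous_eval_const 0
      refine (happ.comp_continuousOn h0).congr fun w _ => ?_
      simp only [comp_apply, iteratedFDeriv_zero_apply]
    have hUc : ContinuousOn (uncurry (U k)) (parabolicCylinder R₁ z₀) :=
      hcontk.mono (hQR.trans hQtop)
    have heq : EqOn (uncurry (U k)) (fun w => V w.1 w.2) (parabolicCylinder R₁ z₀) :=
      Measure.eqOn_open_of_ae_eq (ae_restrict_of_ae_restrict_of_subset hQR hVae)
        (isOpen_parabolicCylinder _ _) hUc hVc
    -- slices agree on the open ball `B(y, R₁)` at the time `s`, so do their derivatives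
    have hslice : ∀ x ∈ ball y R₁, U k s x = V s x := fun x hx =>
      heq (show ((s, x) : ℝ × EuclideanSpace ℝ (Fin 3)) ∈ parabolicCylinder R₁ z₀ from
        (mem_parabolicCylinder).2 ⟨hsR, mem_ball.1 hx⟩)
    have hfd : ∀ x ∈ ball y R₁, fderiv ℝ (U k s) x = fderiv ℝ (V s) x := by
      intro x hx
      refine Filter.EventuallyEq.fderiv_eq ?_
      filter_upwards [isOpen_ball.mem_nhds hx] with x' hx'
      exact hslice x' hx'
    intro y' hy' y'' hy''
    have hm' : ((s, y') : ℝ × EuclideanSpace ℝ (Fin 3)) ∈ parabolicCylinder R₁ z₀ :=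
      (mem_parabolicCylinder).2 ⟨hsR, mem_ball.1 hy'⟩
    have hm'' : ((s, y'') : ℝ × EuclideanSpace ℝ (Fin 3)) ∈ parabolicCylinder R₁ z₀ :=
      (mem_parabolicCylinder).2 ⟨hsR, mem_ball.1 hy''⟩
    refine ⟨?_, ?_⟩
    · rw [hfd y' hy', ← norm_iteratedFDeriv_one]
      exact hK1 (s, y') hm'
    · rw [hfd y' hy', hfd y'' hy'', ← dist_iteratedFDeriv_one]
      have h := hH1.dist_le hm' hm''
      have e : dist ((s, y') : ℝ × EuclideanSpace ℝ (Fin 3)) (s, y'') = dist y' y'' := by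
        rw [Prod.dist_eq, dist_self, max_eq_right dist_nonneg]
      rw [e] at h
      exact h
  exact ⟨key.mono fun k hk y' hy' => (hk y' hy' y' hy').1,
    key.mono fun k hk y' hy' y'' hy'' => (hk y' hy' y'' hy'').2⟩

end HardyAncientLimit

end Summit.NavierStokesRegularity.NavierStokesRegularity.Theorems

end
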